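import Summits.CriticalPhenomena.PercolationContinuityZ3.Theorems.PercNearOneGluingNoHeavyLowerTailSahiPivotFamilyFacet
import Summits.CriticalPhenomena.PercolationContinuityZ3.Theorems.PercNearOneGluingNoHeavyLowerTailSahiPivotFamilyRefutation
import Mathlib
import HarnessLib

/-!
# `NoHeavyLowerTail` (crux stmt-CriticalPhenomena-4575), master-family line P1 (gen 15): REFUTATION of `FacetDomination 3`

Support file (seat `prim-masterthm-p1`, gen 15, same session as the conjecture; `--supports stmt-CriticalPhenomena-4575`).  Corollary of
`not_lowerSectionDomination_three` (explicit witness dual-std3 ∘ (OR₂)³ on `2^6`) and `lowerSectionDomination_of_facetDomination`.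
Memo `run/shared/lean/prim/prim-masterthm/FROM-prim-masterthm-p1-g15-PIVOT-FAMILY.md` §10. [this work]
-/

namespace Summit.CriticalPhenomena.PercolationContinuityZ3.Theorems

namespace SahiPivotFamily

/-- **REFUTATION of facet domination (`k = 3`)**: it contains lower-section domination, which fails on the six-coordinate witness
`F6` (dual standard system composed with OR-blocks of size two). [this work] -/
theorem not_facetDomination_three : ¬ FacetDomination 3 :=
  fun h => not_lowerSectionDomination_three (lowerSectionDomination_of_facetDomination h)

end SahiPivotFamily

end Summit.CriticalPhenomena.PercolationContinuityZ3.Theorems
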